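import Literature.Geometry.Riemannian.ParabolicReGraph
import Literature.Analysis.PDE.ParabolicChainRule
import HarnessLib

/-!
# The normal-part map `f = Q ∘ (L x + u)` of a parabolic graph: jets and bounds

Topic `Literature/Geometry/Riemannian`; part of the re-graphing of a parabolic graph over a nearby
frame (`ParabolicReGraph*.lean`).  For isometric frames `L, L' : ℝᵐ → ℝᴺ`, `π = L'†` and the
complementary projection `Q v = v - L' (π v)` (`‖Q v‖ ≤ ‖v‖`, `norm_normalPart_le`), the map

  `f (x, t) = Q (L x + u (x, t))`

has the jets `D f = Q ∘ (L + D u)`, `∂ₜ f = Q (∂ₜ u)`, `D² f v w = Q (D² u v w)` and satisfies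
the guard where `u` does; its sup bounds and parabolic Hölder moduli are those of `u` (plus the
linear part).  If moreover `Q ∘ (L + A) = 0` for a linear `A` (the new frame `L'` spans the graph
of `A` over `L`), then `f = Q ∘ (u - A x)` and `D f = Q ∘ (D u - A)`: the sup norms of `f`, `D f`
are controlled by `sup ‖u - A x‖`, `sup ‖D u - A‖` (`norm_f_le_of_frame`,
`norm_spaceDeriv_f_le_of_frame`).
The re-graphed function is `u' = f ∘ (χ, t)` (`ParabolicReGraph.exists_regraph`), so
`ParabolicChainRule.lean` turns these into bounds for `u'` (White 2005, p. 1499).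

Everything is PROVED; no definitions, no named facts.

## References

* B. White, *A local regularity theorem for mean curvature flow*, Ann. of Math. 161 (2005), §2.5,
  p. 1499. [White2005]
-/

noncomputable section

open scoped Topology InnerProductSpace NNReal
open Filter

namespace Literature.Geometry.Riemannian

open Literature.Analysis.PDE Literature.Analysis.PDE.Parabolic Metric Set

namespace ParabolicFlow

variable {N m : ℕ}

/-! ### The complementary projection `Q = 1 - L' L'†` -/

/-- Pythagoras for `v = L' (π v) + Q v`: `‖Q v‖ ≤ ‖v‖`. [folklore] -/
theorem norm_normalPart_le (L' : EuclideanSpace ℝ (Fin m) →ₗᵢ[ℝ] EuclideanSpace ℝ (Fin N))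
    (v : EuclideanSpace ℝ (Fin N)) :
    ‖v - L' (L'.toContinuousLinearMap.adjoint v)‖ ≤ ‖v‖ := by
  have horth : ⟪L' (L'.toContinuousLinearMap.adjoint v),
      v - L' (L'.toContinuousLinearMap.adjoint v)⟫_ℝ = 0 := by
    rw [real_inner_comm]; exact inner_sub_frame_eq_zero L' v _
  have h := norm_add_sq_eq_norm_sq_add_norm_sq_of_inner_eq_zero _ _ horth
  rw [frame_add_sub_frame] at h
  nlinarith [norm_nonneg v, norm_nonneg (v - L' (L'.toContinuousLinearMap.adjoint v)),
    sq_nonneg ‖L' (L'.toContinuousLinearMap.adjoint v)‖]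

/-- The complementary projection as a continuous linear map has norm `≤ 1`. [folklore] -/
theorem norm_normalPartCLM_apply_le (L' : EuclideanSpace ℝ (Fin m) →ₗᵢ[ℝ] EuclideanSpace ℝ (Fin N))
    (v : EuclideanSpace ℝ (Fin N)) :
    ‖(ContinuousLinearMap.id ℝ (EuclideanSpace ℝ (Fin N)) -
        L'.toContinuousLinearMap.comp L'.toContinuousLinearMap.adjoint) v‖ ≤ ‖v‖ :=
  norm_normalPart_le L' v

/-- `‖Q ∘ S‖ ≤ ‖S‖`. [folklore] -/
theorem norm_normalPartCLM_comp_le (L' : EuclideanSpace ℝ (Fin m) →ₗᵢ[ℝ] EuclideanSpace ℝ (Fin N))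
    {G : Type*} [NormedAddCommGroup G] [NormedSpace ℝ G] (S : G →L[ℝ] EuclideanSpace ℝ (Fin N)) :
    ‖(ContinuousLinearMap.id ℝ (EuclideanSpace ℝ (Fin N)) -
        L'.toContinuousLinearMap.comp L'.toContinuousLinearMap.adjoint).comp S‖ ≤ ‖S‖ :=
  ContinuousLinearMap.opNorm_le_bound _ (norm_nonneg _) fun g =>
    (norm_normalPartCLM_apply_le L' (S g)).trans (S.le_opNorm g)

/-! ### Jets of `f = Q ∘ (L x + u)` -/

section Jets

variable (L L' : EuclideanSpace ℝ (Fin m) →ₗᵢ[ℝ] EuclideanSpace ℝ (Fin N))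
  {u : Parabolic (EuclideanSpace ℝ (Fin m)) → EuclideanSpace ℝ (Fin N)}
  {U : Set (Parabolic (EuclideanSpace ℝ (Fin m)))} (hu : IsC21On u U)

include hu in
/-- Spatial slices of `f`: derivative `Q ∘ (L + D u)`. [folklore] -/
theorem hasFDerivAt_space_f {x : EuclideanSpace ℝ (Fin m)} {t : ℝ}
    (hX : (⟨x, t⟩ : Parabolic _) ∈ U) :
    HasFDerivAt (fun x' => (L x' + u ⟨x', t⟩) -
        L' (L'.toContinuousLinearMap.adjoint (L x' + u ⟨x', t⟩)))
      ((ContinuousLinearMap.id ℝ (EuclideanSpace ℝ (Fin N)) -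
          L'.toContinuousLinearMap.comp L'.toContinuousLinearMap.adjoint).comp
        (L.toContinuousLinearMap + spaceDeriv u ⟨x, t⟩)) x := by
  have hG : HasFDerivAt (fun x' => L x' + u ⟨x', t⟩) (L.toContinuousLinearMap + spaceDeriv u ⟨x, t⟩)
      x := L.toContinuousLinearMap.hasFDerivAt.add (hu.hasFDerivAt_space hX)
  exact (ContinuousLinearMap.id ℝ (EuclideanSpace ℝ (Fin N)) -
    L'.toContinuousLinearMap.comp L'.toContinuousLinearMap.adjoint).hasFDerivAt.comp x hG

include hu in
/-- `D f = Q ∘ (L + D u)`. [folklore] -/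
theorem spaceDeriv_f {X : Parabolic (EuclideanSpace ℝ (Fin m))} (hX : X ∈ U) :
    spaceDeriv (fun X' : Parabolic (EuclideanSpace ℝ (Fin m)) => (L X'.x + u X') -
        L' (L'.toContinuousLinearMap.adjoint (L X'.x + u X'))) X =
      (ContinuousLinearMap.id ℝ (EuclideanSpace ℝ (Fin N)) -
          L'.toContinuousLinearMap.comp L'.toContinuousLinearMap.adjoint).comp
        (L.toContinuousLinearMap + spaceDeriv u X) := by
  cases X with
  | mk x t => exact (hasFDerivAt_space_f L L' hu hX).fderiv

include hu in
/-- Time slices of `f`: derivative `Q (∂ₜ u)`. [folklore] -/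
theorem hasDerivAt_time_f {x : EuclideanSpace ℝ (Fin m)} {t : ℝ}
    (hX : (⟨x, t⟩ : Parabolic _) ∈ U) :
    HasDerivAt (fun t' => (L x + u ⟨x, t'⟩) -
        L' (L'.toContinuousLinearMap.adjoint (L x + u ⟨x, t'⟩)))
      ((ContinuousLinearMap.id ℝ (EuclideanSpace ℝ (Fin N)) -
          L'.toContinuousLinearMap.comp L'.toContinuousLinearMap.adjoint) (timeDeriv u ⟨x, t⟩))
      t := by
  have hG : HasDerivAt (fun t' => L x + u ⟨x, t'⟩) (timeDeriv u ⟨x, t⟩) t := by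
    simpa using (hu.hasDerivAt_time hX).const_add (L x)
  exact (ContinuousLinearMap.id ℝ (EuclideanSpace ℝ (Fin N)) -
    L'.toContinuousLinearMap.comp L'.toContinuousLinearMap.adjoint).hasFDerivAt.comp_hasDerivAt
    t hG

include hu in
/-- `∂ₜ f = Q (∂ₜ u)`. [folklore] -/
theorem timeDeriv_f {X : Parabolic (EuclideanSpace ℝ (Fin m))} (hX : X ∈ U) :
    timeDeriv (fun X' : Parabolic (EuclideanSpace ℝ (Fin m)) => (L X'.x + u X') -
        L' (L'.toContinuousLinearMap.adjoint (L X'.x + u X'))) X =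
      (ContinuousLinearMap.id ℝ (EuclideanSpace ℝ (Fin N)) -
          L'.toContinuousLinearMap.comp L'.toContinuousLinearMap.adjoint) (timeDeriv u X) := by
  cases X with
  | mk x t => exact (hasDerivAt_time_f L L' hu hX).deriv

include hu in
/-- Spatial slices of `D f` on an open `U`: derivative `(compL Q) ∘ D² u`. [folklore] -/
theorem hasFDerivAt_spaceDeriv_f (hU : IsOpen U) {x : EuclideanSpace ℝ (Fin m)} {t : ℝ}
    (hX : (⟨x, t⟩ : Parabolic _) ∈ U) :
    HasFDerivAt (fun x' => spaceDeriv (fun X' : Parabolic (EuclideanSpace ℝ (Fin m)) =>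
        (L X'.x + u X') - L' (L'.toContinuousLinearMap.adjoint (L X'.x + u X'))) ⟨x', t⟩)
      ((ContinuousLinearMap.compL ℝ (EuclideanSpace ℝ (Fin m)) (EuclideanSpace ℝ (Fin N))
          (EuclideanSpace ℝ (Fin N))
        (ContinuousLinearMap.id ℝ (EuclideanSpace ℝ (Fin N)) -
          L'.toContinuousLinearMap.comp L'.toContinuousLinearMap.adjoint)).comp
        (spaceDeriv (spaceDeriv u) ⟨x, t⟩)) x := by
  have hslice : IsOpen {x' : EuclideanSpace ℝ (Fin m) | (⟨x', t⟩ : Parabolic _) ∈ U} :=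
    hU.preimage (homeomorphProd.symm.continuous.comp (continuous_id.prodMk continuous_const))
  have hev : (fun x' => spaceDeriv (fun X' : Parabolic (EuclideanSpace ℝ (Fin m)) =>
        (L X'.x + u X') - L' (L'.toContinuousLinearMap.adjoint (L X'.x + u X'))) ⟨x', t⟩) =ᶠ[𝓝 x]
      fun x' => (ContinuousLinearMap.id ℝ (EuclideanSpace ℝ (Fin N)) -
          L'.toContinuousLinearMap.comp L'.toContinuousLinearMap.adjoint).comp
        (L.toContinuousLinearMap + spaceDeriv u ⟨x', t⟩) := by
    filter_upwards [hslice.mem_nhds (show x ∈ {x' | (⟨x', t⟩ : Parabolic _) ∈ U} from hX)]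
      with x' hx'
    exact spaceDeriv_f L L' hu hx'
  refine HasFDerivAt.congr_of_eventuallyEq ?_ hev
  have h1 : HasFDerivAt (fun x' => L.toContinuousLinearMap + spaceDeriv u ⟨x', t⟩)
      (spaceDeriv (spaceDeriv u) ⟨x, t⟩) x := by
    simpa using (hu.hasFDerivAt_spaceDeriv hX).const_add L.toContinuousLinearMap
  exact ((ContinuousLinearMap.compL ℝ (EuclideanSpace ℝ (Fin m)) (EuclideanSpace ℝ (Fin N))
    (EuclideanSpace ℝ (Fin N))) (ContinuousLinearMap.id ℝ (EuclideanSpace ℝ (Fin N)) -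
      L'.toContinuousLinearMap.comp L'.toContinuousLinearMap.adjoint)).hasFDerivAt.comp x h1

include hu in
/-- `D² f v w = Q (D² u v w)` on an open `U`. [folklore] -/
theorem spaceDeriv_spaceDeriv_f (hU : IsOpen U) {X : Parabolic (EuclideanSpace ℝ (Fin m))}
    (hX : X ∈ U) (v w : EuclideanSpace ℝ (Fin m)) :
    spaceDeriv (spaceDeriv fun X' : Parabolic (EuclideanSpace ℝ (Fin m)) =>
        (L X'.x + u X') - L' (L'.toContinuousLinearMap.adjoint (L X'.x + u X'))) X v w =
      (ContinuousLinearMap.id ℝ (EuclideanSpace ℝ (Fin N)) -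
          L'.toContinuousLinearMap.comp L'.toContinuousLinearMap.adjoint)
        (spaceDeriv (spaceDeriv u) X v w) := by
  cases X with
  | mk x t =>
    rw [show spaceDeriv (spaceDeriv fun X' : Parabolic (EuclideanSpace ℝ (Fin m)) =>
        (L X'.x + u X') - L' (L'.toContinuousLinearMap.adjoint (L X'.x + u X'))) ⟨x, t⟩ = _ from
      (hasFDerivAt_spaceDeriv_f L L' hu hU hX).fderiv]
    rfl

include hu in
/-- `f` satisfies the regularity guard on an open `U`. [folklore] -/
theorem isC21On_f (hU : IsOpen U) :
    IsC21On (fun X' : Parabolic (EuclideanSpace ℝ (Fin m)) =>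
      (L X'.x + u X') - L' (L'.toContinuousLinearMap.adjoint (L X'.x + u X'))) U := by
  refine ⟨fun X hX => ?_, fun X hX => ?_⟩
  · have hG : DifferentiableAt ℝ
        (fun p : EuclideanSpace ℝ (Fin m) × ℝ => L p.1 + u ⟨p.1, p.2⟩) (X.x, X.t) :=
      (L.toContinuousLinearMap.differentiableAt.comp _ differentiableAt_fst).add
        (hu.differentiableAt X hX)
    exact hG.sub
      ((L'.toContinuousLinearMap.comp L'.toContinuousLinearMap.adjoint).differentiableAt.comp _ hG)
  · cases X with
    | mk x t => exact (hasFDerivAt_spaceDeriv_f L L' hu hU hX).differentiableAt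

end Jets

/-! ### Bounds for the jets of `f` in terms of those of `u` -/

section Bounds

variable (L L' : EuclideanSpace ℝ (Fin m) →ₗᵢ[ℝ] EuclideanSpace ℝ (Fin N))
  {u : Parabolic (EuclideanSpace ℝ (Fin m)) → EuclideanSpace ℝ (Fin N)}
  {U : Set (Parabolic (EuclideanSpace ℝ (Fin m)))} (hu : IsC21On u U)

include hu in
/-- `‖D f‖ ≤ 1 + ‖D u‖`. [folklore] -/
theorem norm_spaceDeriv_f_le {X : Parabolic (EuclideanSpace ℝ (Fin m))} (hX : X ∈ U) {B₁ : ℝ}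
    (hB₁ : ‖spaceDeriv u X‖ ≤ B₁) :
    ‖spaceDeriv (fun X' : Parabolic (EuclideanSpace ℝ (Fin m)) => (L X'.x + u X') -
        L' (L'.toContinuousLinearMap.adjoint (L X'.x + u X'))) X‖ ≤ 1 + B₁ := by
  rw [spaceDeriv_f L L' hu hX]
  refine (norm_normalPartCLM_comp_le L' _).trans ((norm_add_le _ _).trans (add_le_add ?_ hB₁))
  exact L.norm_toContinuousLinearMap_le

include hu in
/-- `‖D f X - D f X'‖ ≤ ‖D u X - D u X'‖`. [folklore] -/
theorem norm_spaceDeriv_f_sub_le {X X' : Parabolic (EuclideanSpace ℝ (Fin m))} (hX : X ∈ U)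
    (hX' : X' ∈ U) :
    ‖spaceDeriv (fun X' : Parabolic (EuclideanSpace ℝ (Fin m)) => (L X'.x + u X') -
          L' (L'.toContinuousLinearMap.adjoint (L X'.x + u X'))) X -
        spaceDeriv (fun X' : Parabolic (EuclideanSpace ℝ (Fin m)) => (L X'.x + u X') -
          L' (L'.toContinuousLinearMap.adjoint (L X'.x + u X'))) X'‖ ≤
      ‖spaceDeriv u X - spaceDeriv u X'‖ := by
  rw [spaceDeriv_f L L' hu hX, spaceDeriv_f L L' hu hX', ← ContinuousLinearMap.comp_sub,
    add_sub_add_left_eq_sub]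
  exact norm_normalPartCLM_comp_le L' _

include hu in
/-- `‖∂ₜ f‖ ≤ ‖∂ₜ u‖`. [folklore] -/
theorem norm_timeDeriv_f_le {X : Parabolic (EuclideanSpace ℝ (Fin m))} (hX : X ∈ U) :
    ‖timeDeriv (fun X' : Parabolic (EuclideanSpace ℝ (Fin m)) => (L X'.x + u X') -
        L' (L'.toContinuousLinearMap.adjoint (L X'.x + u X'))) X‖ ≤ ‖timeDeriv u X‖ := by
  rw [timeDeriv_f L L' hu hX]
  exact norm_normalPartCLM_apply_le L' _

include hu in
/-- `‖∂ₜ f X - ∂ₜ f X'‖ ≤ ‖∂ₜ u X - ∂ₜ u X'‖`. [folklore] -/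
theorem norm_timeDeriv_f_sub_le {X X' : Parabolic (EuclideanSpace ℝ (Fin m))} (hX : X ∈ U)
    (hX' : X' ∈ U) :
    ‖timeDeriv (fun X' : Parabolic (EuclideanSpace ℝ (Fin m)) => (L X'.x + u X') -
          L' (L'.toContinuousLinearMap.adjoint (L X'.x + u X'))) X -
        timeDeriv (fun X' : Parabolic (EuclideanSpace ℝ (Fin m)) => (L X'.x + u X') -
          L' (L'.toContinuousLinearMap.adjoint (L X'.x + u X'))) X'‖ ≤
      ‖timeDeriv u X - timeDeriv u X'‖ := by
  rw [timeDeriv_f L L' hu hX, timeDeriv_f L L' hu hX', ← map_sub]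
  exact norm_normalPartCLM_apply_le L' _

include hu in
/-- `‖D² f‖ ≤ ‖D² u‖` on an open `U`. [folklore] -/
theorem norm_spaceDeriv_spaceDeriv_f_le (hU : IsOpen U) {X : Parabolic (EuclideanSpace ℝ (Fin m))}
    (hX : X ∈ U) :
    ‖spaceDeriv (spaceDeriv fun X' : Parabolic (EuclideanSpace ℝ (Fin m)) => (L X'.x + u X') -
        L' (L'.toContinuousLinearMap.adjoint (L X'.x + u X'))) X‖ ≤
      ‖spaceDeriv (spaceDeriv u) X‖ := by
  refine ContinuousLinearMap.opNorm_le_bound _ (norm_nonneg _) fun v => ?_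
  refine ContinuousLinearMap.opNorm_le_bound _ (by positivity) fun w => ?_
  rw [spaceDeriv_spaceDeriv_f L L' hu hU hX]
  exact (norm_normalPartCLM_apply_le L' _).trans (ContinuousLinearMap.le_opNorm₂ _ _ _)

include hu in
/-- `‖D² f X - D² f X'‖ ≤ ‖D² u X - D² u X'‖` on an open `U`. [folklore] -/
theorem norm_spaceDeriv_spaceDeriv_f_sub_le (hU : IsOpen U)
    {X X' : Parabolic (EuclideanSpace ℝ (Fin m))} (hX : X ∈ U) (hX' : X' ∈ U) :
    ‖spaceDeriv (spaceDeriv fun X' : Parabolic (EuclideanSpace ℝ (Fin m)) => (L X'.x + u X') -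
          L' (L'.toContinuousLinearMap.adjoint (L X'.x + u X'))) X -
        spaceDeriv (spaceDeriv fun X' : Parabolic (EuclideanSpace ℝ (Fin m)) => (L X'.x + u X') -
          L' (L'.toContinuousLinearMap.adjoint (L X'.x + u X'))) X'‖ ≤
      ‖spaceDeriv (spaceDeriv u) X - spaceDeriv (spaceDeriv u) X'‖ := by
  refine ContinuousLinearMap.opNorm_le_bound _ (norm_nonneg _) fun v => ?_
  refine ContinuousLinearMap.opNorm_le_bound _ (by positivity) fun w => ?_
  rw [sub_apply, sub_apply, spaceDeriv_spaceDeriv_f L L' hu hU hX,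
    spaceDeriv_spaceDeriv_f L L' hu hU hX', ← map_sub]
  refine (norm_normalPartCLM_apply_le L' _).trans ?_
  rw [← sub_apply, ← sub_apply]
  exact ContinuousLinearMap.le_opNorm₂ _ _ _

/-- The values of `f`: `‖f X - f X'‖ ≤ ‖x - x'‖ + ‖u X - u X'‖`. [folklore] -/
theorem norm_f_sub_le (X X' : Parabolic (EuclideanSpace ℝ (Fin m))) :
    ‖((L X.x + u X) - L' (L'.toContinuousLinearMap.adjoint (L X.x + u X))) -
        ((L X'.x + u X') - L' (L'.toContinuousLinearMap.adjoint (L X'.x + u X')))‖ ≤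
      ‖X.x - X'.x‖ + ‖u X - u X'‖ := by
  have h : ((L X.x + u X) - L' (L'.toContinuousLinearMap.adjoint (L X.x + u X))) -
      ((L X'.x + u X') - L' (L'.toContinuousLinearMap.adjoint (L X'.x + u X'))) =
      (L (X.x - X'.x) + (u X - u X')) -
        L' (L'.toContinuousLinearMap.adjoint (L (X.x - X'.x) + (u X - u X'))) := by
    simp only [map_sub, map_add]
    abel
  rw [h]
  refine (norm_normalPart_le L' _).trans ((norm_add_le _ _).trans (add_le_add ?_ le_rfl))
  rw [L.norm_map]

/-! ### Smallness relative to a frame spanning the graph of `A` -/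

/-- If `Q ∘ (L + A) = 0` then `f X = Q (u X - A x)`, so `‖f X‖ ≤ ‖u X - A x‖`. [folklore] -/
theorem norm_f_le_of_frame (A : EuclideanSpace ℝ (Fin m) →L[ℝ] EuclideanSpace ℝ (Fin N))
    (hQA : ∀ x, (L x + A x) - L' (L'.toContinuousLinearMap.adjoint (L x + A x)) = 0)
    (X : Parabolic (EuclideanSpace ℝ (Fin m))) :
    ‖(L X.x + u X) - L' (L'.toContinuousLinearMap.adjoint (L X.x + u X))‖ ≤ ‖u X - A X.x‖ := by
  have h : (L X.x + u X) - L' (L'.toContinuousLinearMap.adjoint (L X.x + u X)) =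
      ((L X.x + A X.x) - L' (L'.toContinuousLinearMap.adjoint (L X.x + A X.x))) +
        ((u X - A X.x) - L' (L'.toContinuousLinearMap.adjoint (u X - A X.x))) := by
    simp only [map_sub, map_add]
    abel
  rw [h, hQA, zero_add]
  exact norm_normalPart_le L' _

include hu in
/-- If `Q ∘ (L + A) = 0` then `D f = Q ∘ (D u - A)`, so `‖D f X‖ ≤ ‖D u X - A‖`. [folklore] -/
theorem norm_spaceDeriv_f_le_of_frame (A : EuclideanSpace ℝ (Fin m) →L[ℝ] EuclideanSpace ℝ (Fin N))
    (hQA : ∀ x, (L x + A x) - L' (L'.toContinuousLinearMap.adjoint (L x + A x)) = 0)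
    {X : Parabolic (EuclideanSpace ℝ (Fin m))} (hX : X ∈ U) :
    ‖spaceDeriv (fun X' : Parabolic (EuclideanSpace ℝ (Fin m)) => (L X'.x + u X') -
        L' (L'.toContinuousLinearMap.adjoint (L X'.x + u X'))) X‖ ≤ ‖spaceDeriv u X - A‖ := by
  rw [spaceDeriv_f L L' hu hX]
  have hQA' : (ContinuousLinearMap.id ℝ (EuclideanSpace ℝ (Fin N)) -
      L'.toContinuousLinearMap.comp L'.toContinuousLinearMap.adjoint).comp
        (L.toContinuousLinearMap + A) = 0 := by
    ext1 x
    have h := hQA x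
    simp only [ContinuousLinearMap.coe_comp, Function.comp_apply, add_apply,
      sub_apply, ContinuousLinearMap.id_apply, zero_apply,
      LinearIsometry.coe_toContinuousLinearMap]
    rw [← h]
  have h : (ContinuousLinearMap.id ℝ (EuclideanSpace ℝ (Fin N)) -
      L'.toContinuousLinearMap.comp L'.toContinuousLinearMap.adjoint).comp
        (L.toContinuousLinearMap + spaceDeriv u X) =
      (ContinuousLinearMap.id ℝ (EuclideanSpace ℝ (Fin N)) -
        L'.toContinuousLinearMap.comp L'.toContinuousLinearMap.adjoint).comp
          (spaceDeriv u X - A) := by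
    have : L.toContinuousLinearMap + spaceDeriv u X =
        (L.toContinuousLinearMap + A) + (spaceDeriv u X - A) := by abel
    rw [this, ContinuousLinearMap.comp_add, hQA', zero_add]
  rw [h]
  exact norm_normalPartCLM_comp_le L' _

end Bounds

end ParabolicFlow

end Literature.Geometry.Riemannian
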